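import Mathlib
import HarnessLib
import Summits.NavierStokesRegularity.NavierStokesRegularity.Theorems.PoloidalWindowDoorLrcModEntireTwistingThickOfLocalOpen
import Summits.NavierStokesRegularity.NavierStokesRegularity.Theorems.PoloidalWindowDoorPoloidalWindowRigidityHyperbolicThickOfLocalOpen

/-!
# Route `PoloidalWindowDoor`, item `LrcModEntire` (stmt-NavierStokesRegularity-20428) / crux `PoloidalWindowRigidity` (K2, stmt-19708) —
# THE LEAFWISE IDENTITY `∇ₕΛ ∥ ∇ₕu₂` and the THICK column from the local statement pinned by `∂ₙΛ ≠ 0`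

Cell ns-regularity-ideate, seat ns-poloidal-K2-p4 gen 0 (THICK column; lead ns-poloidal-K2-p2; `--supports stmt-NavierStokesRegularity-20428`
helper).  Sequel of `…LrcModEntireTwistingThickOfLocalOpen` (p576963) and `…HyperbolicThickOfLocalOpen` (p576329): the KINEMATIC identity that
turns their pin `∇ₕΛ ≠ 0` into the engines' form (cert-1 «`∂ₙμ ≠ 0` at the pin», nsreg-p7 `G_uu ≠ 0`):

* `fderiv_entry_symm` — Clairaut componentwise for a vector field `C²` at a point;
* `slopeGrad_cross_grad_eq_zero` — **LEAFWISE IDENTITY (pointwise, kinematic):** `V : ℝ³ → ℝ³` `C²` at `x`, poloidal along `e₃`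
  (`∂₀V₁ = ∂₁V₀`), frozen (`∂₂V₀·∂₁V₂ = ∂₂V₁·∂₀V₂`) and `∇ₕV₂ ≠ 0` near `x` ⇒ `∂₀Λ·∂₁V₂ = ∂₁Λ·∂₀V₂` at `x` for the shear ratio
  `Λ = ⟪∂₂Vₕ,∇ₕV₂⟩/|∇ₕV₂|²` (curlₕ of `∂₂Vₕ = Λ∇ₕV₂`, using `curlₕVₕ = 0` and the symmetry of second derivatives): the slope is constant along the
  horizontal level lines of `V₂`, i.e. a function of `(V₂, x₂)` on the leaves — so `∇ₕΛ ≠ 0 ⇔ ∂ₙΛ := ⟪∇ₕΛ, ∇ₕV₂⟩ ≠ 0` (`inner_ne_zero_of_cross_eq_zero`);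
* `localThickOpen_of_localThickLeaf` — the local statement `hthick` FOLLOWS from the formally weaker
  `hleaf` := «no real-analytic classical NS pair `(u,q)` on a nonempty open `U` is at every point of `U` poloidal ∧ frozen ∧ non-degenerate ∧ twisting ∧
  LEAFWISE (`∂₀Λ·∂₁u₂ = ∂₁Λ·∂₀u₂`) ∧ `∂ₙΛ ≠ 0` (`∂₀Λ·∂₀u₂ + ∂₁Λ·∂₁u₂ ≠ 0`)» (a germ satisfying the hypotheses of `hthick` satisfies those of
  `hleaf`: leafwise by the identity, `∂ₙΛ ≠ 0` from `∇ₕΛ ≠ 0`);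
* `stub_twistingThick_of_localThickLeaf`, `stub_hyperbolicThick_of_localThickLeaf` — the two registered THICK stubs (item 20428 `twist_split` v4,
  crux 19708 `mixed_type` v1) VERBATIM from `hleaf`.

WHAT THIS IS NOT: not a proof of either stub or of anything about Navier–Stokes regularity (Clay (A) untouched) — kinematics + bookkeeping: the THICK
column's by-name local target in the engines' pin variables.  bears_on LADDER-NS N0, item 20428, crux 19708.
-/

noncomputable section

-- the summit and its single sub-problem share the name (CONVENTIONS §1), as in every Theorems file
set_option linter.dupNamespace false

namespace Summit.NavierStokesRegularity.NavierStokesRegularity.Theorems.PoloidalWindowDoorLrcModEntireTwistingThickLeafwise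

open Set Function Metric Filter
open scoped RealInnerProductSpace InnerProductSpace Topology
open Literature.Analysis Literature.Analysis.FluidPDE
open Summit.NavierStokesRegularity.NavierStokesRegularity.Theorems
open Summit.NavierStokesRegularity.NavierStokesRegularity.Theorems.PoloidalWindowDoorPoloidalWindowRigidityK2OfLrcSlope
open Summit.NavierStokesRegularity.NavierStokesRegularity.Theorems.PoloidalWindowDoorPoloidalWindowRigidityProportionalShear
open Summit.NavierStokesRegularity.NavierStokesRegularity.Theorems.PoloidalWindowDoorPoloidalWindowRigidityHyperbolicThickOfLocalOpen
open Summit.NavierStokesRegularity.NavierStokesRegularity.Theorems.PoloidalWindowDoorLrcModEntireTwistingThickOfLocalOpen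

/-! ### Clairaut componentwise; the leafwise identity -/

/-- Symmetry of mixed directional second partials of a vector field `V : ℝ³ → ℝ³` that is `C²` at `x`, componentwise:
`∂_w(∂_uV_j)(x) = ∂_u(∂_wV_j)(x)`. -/
theorem fderiv_entry_symm {V : EuclideanSpace ℝ (Fin 3) → EuclideanSpace ℝ (Fin 3)} {x : EuclideanSpace ℝ (Fin 3)}
    (hV : ContDiffAt ℝ 2 V x) (u w : EuclideanSpace ℝ (Fin 3)) (j : Fin 3) :
    fderiv ℝ (fun y => fderiv ℝ V y u j) x w = fderiv ℝ (fun y => fderiv ℝ V y w j) x u := by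
  have hd : DifferentiableAt ℝ (fderiv ℝ V) x := (hV.fderiv_right (m := 1) (by norm_num)).differentiableAt one_ne_zero
  have hvec : ∀ u w : EuclideanSpace ℝ (Fin 3),
      fderiv ℝ (fun y => fderiv ℝ V y u) x w = fderiv ℝ (fderiv ℝ V) x w u := by
    intro u w
    rw [fderiv_clm_apply hd (differentiableAt_const u)]
    simp only [fderiv_fun_const, Pi.zero_apply, ContinuousLinearMap.comp_zero, zero_add,
      ContinuousLinearMap.flip_apply]
  have hcomp : ∀ u w : EuclideanSpace ℝ (Fin 3),
      fderiv ℝ (fun y => fderiv ℝ V y u j) x w = (fderiv ℝ (fun y => fderiv ℝ V y u) x w) j := by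
    intro u w
    have hdu : DifferentiableAt ℝ (fun y => fderiv ℝ V y u) x := hd.clm_apply (differentiableAt_const u)
    have e : (fun y => fderiv ℝ V y u j) = (EuclideanSpace.proj j : EuclideanSpace ℝ (Fin 3) →L[ℝ] ℝ) ∘
        (fun y => fderiv ℝ V y u) := by
      funext y; rfl
    rw [e, fderiv_comp x (EuclideanSpace.proj j : EuclideanSpace ℝ (Fin 3) →L[ℝ] ℝ).differentiableAt hdu,
      ContinuousLinearMap.fderiv]
    rfl
  rw [hcomp, hcomp, hvec, hvec]
  exact congrFun (congrArg _ ((hV.isSymmSndFDerivAt (by simp)) w u)) j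

/-- **Leafwise identity (kinematic).**  For a vector field `V : ℝ³ → ℝ³`, `C²` at `x`, poloidal along `e₃` near `x` (`(curl V)₂ = 0`), frozen near
`x` (`∂₂V₀·∂₁V₂ = ∂₂V₁·∂₀V₂`) with `∇ₕV₂ ≠ 0` near `x`: the horizontal gradient of the shear ratio `Λ = ⟪∂₂Vₕ,∇ₕV₂⟩/|∇ₕV₂|²` is parallel
to `∇ₕV₂` at `x` — `∂₀Λ·∂₁V₂ = ∂₁Λ·∂₀V₂` (curlₕ of `∂₂Vₕ = Λ∇ₕV₂`, using `curlₕVₕ = 0` and Clairaut). -/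
theorem slopeGrad_cross_grad_eq_zero {V : EuclideanSpace ℝ (Fin 3) → EuclideanSpace ℝ (Fin 3)} {x : EuclideanSpace ℝ (Fin 3)}
    (hV : ContDiffAt ℝ 2 V x)
    (hpol : ∀ᶠ y in 𝓝 x, fderiv ℝ V y (EuclideanSpace.single 0 1) 1 = fderiv ℝ V y (EuclideanSpace.single 1 1) 0)
    (hfr : ∀ᶠ y in 𝓝 x, fderiv ℝ V y (EuclideanSpace.single 2 1) 0 * fderiv ℝ V y (EuclideanSpace.single 1 1) 2 =
      fderiv ℝ V y (EuclideanSpace.single 2 1) 1 * fderiv ℝ V y (EuclideanSpace.single 0 1) 2)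
    (hnd : ∀ᶠ y in 𝓝 x, fderiv ℝ V y (EuclideanSpace.single 0 1) 2 ≠ 0 ∨ fderiv ℝ V y (EuclideanSpace.single 1 1) 2 ≠ 0) :
    fderiv ℝ (fun y => (fderiv ℝ V y (EuclideanSpace.single 2 1) 0 * fderiv ℝ V y (EuclideanSpace.single 0 1) 2 +
          fderiv ℝ V y (EuclideanSpace.single 2 1) 1 * fderiv ℝ V y (EuclideanSpace.single 1 1) 2) /
        (fderiv ℝ V y (EuclideanSpace.single 0 1) 2 ^ 2 + fderiv ℝ V y (EuclideanSpace.single 1 1) 2 ^ 2)) x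
        (EuclideanSpace.single 0 1) * fderiv ℝ V x (EuclideanSpace.single 1 1) 2 =
      fderiv ℝ (fun y => (fderiv ℝ V y (EuclideanSpace.single 2 1) 0 * fderiv ℝ V y (EuclideanSpace.single 0 1) 2 +
          fderiv ℝ V y (EuclideanSpace.single 2 1) 1 * fderiv ℝ V y (EuclideanSpace.single 1 1) 2) /
        (fderiv ℝ V y (EuclideanSpace.single 0 1) 2 ^ 2 + fderiv ℝ V y (EuclideanSpace.single 1 1) 2 ^ 2)) x
        (EuclideanSpace.single 1 1) * fderiv ℝ V x (EuclideanSpace.single 0 1) 2 := by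
  -- names: `A b = ∂₂V_b`, `g b = ∂_bV₂`, `Λ` the ratio
  set A : Fin 3 → EuclideanSpace ℝ (Fin 3) → ℝ := fun b y => fderiv ℝ V y (EuclideanSpace.single 2 1) b with hA
  set g : Fin 3 → EuclideanSpace ℝ (Fin 3) → ℝ := fun b y => fderiv ℝ V y (EuclideanSpace.single b 1) 2 with hg
  -- differentiability at `x` of the entries and of the ratio
  have hd : DifferentiableAt ℝ (fderiv ℝ V) x := (hV.fderiv_right (m := 1) (by norm_num)).differentiableAt one_ne_zero
  have hent : ∀ (u : EuclideanSpace ℝ (Fin 3)) (j : Fin 3), DifferentiableAt ℝ (fun y => fderiv ℝ V y u j) x := by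
    intro u j
    have hdu : DifferentiableAt ℝ (fun y => fderiv ℝ V y u) x := hd.clm_apply (differentiableAt_const u)
    exact (EuclideanSpace.proj j : EuclideanSpace ℝ (Fin 3) →L[ℝ] ℝ).differentiableAt.comp x hdu
  have hAd : ∀ b, DifferentiableAt ℝ (A b) x := fun b => hent _ _
  have hgd : ∀ b, DifferentiableAt ℝ (g b) x := fun b => hent _ _
  have hden : g 0 x ^ 2 + g 1 x ^ 2 ≠ 0 := by
    rcases hnd.self_of_nhds with h | h
    · have h' : 0 < g 0 x ^ 2 := by simp only [hg]; positivity
      have := sq_nonneg (g 1 x)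
      exact ne_of_gt (by linarith)
    · have h' : 0 < g 1 x ^ 2 := by simp only [hg]; positivity
      have := sq_nonneg (g 0 x)
      exact ne_of_gt (by linarith)
  have hnum_d : DifferentiableAt ℝ (fun y => A 0 y * g 0 y + A 1 y * g 1 y) x :=
    ((hAd 0).mul (hgd 0)).add ((hAd 1).mul (hgd 1))
  have hden_d : DifferentiableAt ℝ (fun y => g 0 y ^ 2 + g 1 y ^ 2) x := ((hgd 0).pow 2).add ((hgd 1).pow 2)
  have hΛd : DifferentiableAt ℝ (fun y => (A 0 y * g 0 y + A 1 y * g 1 y) / (g 0 y ^ 2 + g 1 y ^ 2)) x := by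
    have h := hnum_d.fun_mul (hden_d.fun_inv hden)
    simpa only [div_eq_mul_inv] using h
  set Λ : EuclideanSpace ℝ (Fin 3) → ℝ := fun y => (A 0 y * g 0 y + A 1 y * g 1 y) / (g 0 y ^ 2 + g 1 y ^ 2) with hΛ
  -- near `x`: `A b = Λ * g b`
  have hprop : ∀ b : Fin 3, b ≠ 2 → (A b) =ᶠ[𝓝 x] (fun y => Λ y * g b y) := by
    intro b hb
    filter_upwards [hfr, hnd] with y hy hy'
    have h := eq_ratio_mul_of_frozen hy hy'
    fin_cases b
    · exact h.1
    · exact h.2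
    · exact absurd rfl hb
  -- differentiate `A 1 = Λ g 1` along `e₀` and `A 0 = Λ g 0` along `e₁`
  have e1 : fderiv ℝ (A 1) x (EuclideanSpace.single 0 1) =
      fderiv ℝ Λ x (EuclideanSpace.single 0 1) * g 1 x + Λ x * fderiv ℝ (g 1) x (EuclideanSpace.single 0 1) := by
    rw [(hprop 1 (by decide)).fderiv_eq, fderiv_fun_mul hΛd (hgd 1)]
    simp only [FunLike.coe_add, FunLike.coe_smul, Pi.add_apply, Pi.smul_apply, smul_eq_mul]
    ring
  have e2 : fderiv ℝ (A 0) x (EuclideanSpace.single 1 1) =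
      fderiv ℝ Λ x (EuclideanSpace.single 1 1) * g 0 x + Λ x * fderiv ℝ (g 0) x (EuclideanSpace.single 1 1) := by
    rw [(hprop 0 (by decide)).fderiv_eq, fderiv_fun_mul hΛd (hgd 0)]
    simp only [FunLike.coe_add, FunLike.coe_smul, Pi.add_apply, Pi.smul_apply, smul_eq_mul]
    ring
  -- Clairaut + poloidality: `∂₀A₁ = ∂₁A₀` and `∂₀g₁ = ∂₁g₀`
  have e3 : fderiv ℝ (A 1) x (EuclideanSpace.single 0 1) = fderiv ℝ (A 0) x (EuclideanSpace.single 1 1) := by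
    simp only [hA]
    have hpol' : (fun y => fderiv ℝ V y (EuclideanSpace.single 0 1) 1) =ᶠ[𝓝 x]
        (fun y => fderiv ℝ V y (EuclideanSpace.single 1 1) 0) := hpol
    rw [fderiv_entry_symm hV, hpol'.fderiv_eq, fderiv_entry_symm hV]
  have e4 : fderiv ℝ (g 1) x (EuclideanSpace.single 0 1) = fderiv ℝ (g 0) x (EuclideanSpace.single 1 1) := by
    simp only [hg]
    rw [fderiv_entry_symm hV]
  -- conclude
  show fderiv ℝ Λ x (EuclideanSpace.single 0 1) * g 1 x = fderiv ℝ Λ x (EuclideanSpace.single 1 1) * g 0 x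
  have := e1.symm.trans (e3.trans e2)
  rw [e4] at this
  linarith


/-! ### Algebra: parallel and non-zero ⇒ non-orthogonal -/

/-- If `(a,b) ∥ (g₀,g₁)` (`a g₁ = b g₀`), `(a,b) ≠ 0` and `(g₀,g₁) ≠ 0`, then `⟪(a,b),(g₀,g₁)⟫ = a g₀ + b g₁ ≠ 0`. [folklore] -/
theorem inner_ne_zero_of_cross_eq_zero {a b g₀ g₁ : ℝ} (hpar : a * g₁ = b * g₀) (hab : a ≠ 0 ∨ b ≠ 0) (hg : g₀ ≠ 0 ∨ g₁ ≠ 0) :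
    a * g₀ + b * g₁ ≠ 0 := by
  intro h
  have hsum : 0 < g₀ ^ 2 + g₁ ^ 2 := by
    rcases hg with h' | h'
    · have : 0 < g₀ ^ 2 := by positivity
      nlinarith [sq_nonneg g₁]
    · have : 0 < g₁ ^ 2 := by positivity
      nlinarith [sq_nonneg g₀]
  have ha : a * (g₀ ^ 2 + g₁ ^ 2) = 0 := by linear_combination g₀ * h + g₁ * hpar
  have hb : b * (g₀ ^ 2 + g₁ ^ 2) = 0 := by linear_combination g₁ * h - g₀ * hpar
  have ha0 : a = 0 := (mul_eq_zero.1 ha).resolve_right (ne_of_gt hsum)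
  have hb0 : b = 0 := (mul_eq_zero.1 hb).resolve_right (ne_of_gt hsum)
  exact hab.elim (fun h' => h' ha0) (fun h' => h' hb0)

/-! ### `hleaf ⇒ hthick` (purely local), and the two THICK stubs from `hleaf` -/

/-- **The pointwise-open local statement `hthick` follows from the leafwise-pinned one `hleaf`.**  Given a germ as in `hthick` (analytic classical
NS pair on an open `U`, everywhere poloidal, frozen, non-degenerate, twisting, `∇ₕΛ ≠ 0`), the leafwise identity holds at every point of `U`
(`slopeGrad_cross_grad_eq_zero`: the slice `u t` is analytic, hence `C²`, at the points of the open section of `U`), and then `∂ₙΛ ≠ 0`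
(`inner_ne_zero_of_cross_eq_zero`); so `hleaf` applies. -/
theorem localThickOpen_of_localThickLeaf
    (hleaf : ∀ (u : ℝ → EuclideanSpace ℝ (Fin 3) → EuclideanSpace ℝ (Fin 3)) (q : ℝ → EuclideanSpace ℝ (Fin 3) → ℝ)
        (U : Set (ℝ × EuclideanSpace ℝ (Fin 3))),
        IsOpen U → U.Nonempty →
        Literature.Analysis.FluidPDE.IsClassicalNSSolutionOnRegion U 1 0 u q →
        AnalyticOnNhd ℝ (Function.uncurry u) U →
        (∀ p ∈ U, ⟪Literature.Analysis.FluidPDE.curl (u p.1) p.2, EuclideanSpace.single 2 1⟫_ℝ = 0) →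
        (∀ p ∈ U, fderiv ℝ (u p.1) p.2 (EuclideanSpace.single 2 1) 0 * fderiv ℝ (u p.1) p.2 (EuclideanSpace.single 1 1) 2 =
          fderiv ℝ (u p.1) p.2 (EuclideanSpace.single 2 1) 1 * fderiv ℝ (u p.1) p.2 (EuclideanSpace.single 0 1) 2) →
        (∀ p ∈ U, Literature.Analysis.FluidPDE.curl (u p.1) p.2 ≠ 0 ∧
          (fderiv ℝ (u p.1) p.2 (EuclideanSpace.single 0 1) 2 ≠ 0 ∨ fderiv ℝ (u p.1) p.2 (EuclideanSpace.single 1 1) 2 ≠ 0) ∧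
          (fderiv ℝ (u p.1) p.2 (EuclideanSpace.single 2 1) 0 ≠ 0 ∨ fderiv ℝ (u p.1) p.2 (EuclideanSpace.single 2 1) 1 ≠ 0)) →
        (∀ p ∈ U,
          fderiv ℝ (fun y => fderiv ℝ (u p.1) y (EuclideanSpace.single 2 1) 2) p.2 (EuclideanSpace.single 0 1) *
              fderiv ℝ (u p.1) p.2 (EuclideanSpace.single 1 1) 2 -
            fderiv ℝ (fun y => fderiv ℝ (u p.1) y (EuclideanSpace.single 2 1) 2) p.2 (EuclideanSpace.single 1 1) *
              fderiv ℝ (u p.1) p.2 (EuclideanSpace.single 0 1) 2 ≠ 0) →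
        (∀ p ∈ U,
          fderiv ℝ (fun y => (fderiv ℝ (u p.1) y (EuclideanSpace.single 2 1) 0 * fderiv ℝ (u p.1) y (EuclideanSpace.single 0 1) 2 +
              fderiv ℝ (u p.1) y (EuclideanSpace.single 2 1) 1 * fderiv ℝ (u p.1) y (EuclideanSpace.single 1 1) 2) /
            (fderiv ℝ (u p.1) y (EuclideanSpace.single 0 1) 2 ^ 2 + fderiv ℝ (u p.1) y (EuclideanSpace.single 1 1) 2 ^ 2)) p.2 (EuclideanSpace.single 0 1) * fderiv ℝ (u p.1) p.2 (EuclideanSpace.single 1 1) 2 =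
          fderiv ℝ (fun y => (fderiv ℝ (u p.1) y (EuclideanSpace.single 2 1) 0 * fderiv ℝ (u p.1) y (EuclideanSpace.single 0 1) 2 +
              fderiv ℝ (u p.1) y (EuclideanSpace.single 2 1) 1 * fderiv ℝ (u p.1) y (EuclideanSpace.single 1 1) 2) /
            (fderiv ℝ (u p.1) y (EuclideanSpace.single 0 1) 2 ^ 2 + fderiv ℝ (u p.1) y (EuclideanSpace.single 1 1) 2 ^ 2)) p.2 (EuclideanSpace.single 1 1) * fderiv ℝ (u p.1) p.2 (EuclideanSpace.single 0 1) 2) →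
        (∀ p ∈ U,
          fderiv ℝ (fun y => (fderiv ℝ (u p.1) y (EuclideanSpace.single 2 1) 0 * fderiv ℝ (u p.1) y (EuclideanSpace.single 0 1) 2 +
              fderiv ℝ (u p.1) y (EuclideanSpace.single 2 1) 1 * fderiv ℝ (u p.1) y (EuclideanSpace.single 1 1) 2) /
            (fderiv ℝ (u p.1) y (EuclideanSpace.single 0 1) 2 ^ 2 + fderiv ℝ (u p.1) y (EuclideanSpace.single 1 1) 2 ^ 2)) p.2 (EuclideanSpace.single 0 1) * fderiv ℝ (u p.1) p.2 (EuclideanSpace.single 0 1) 2 +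
          fderiv ℝ (fun y => (fderiv ℝ (u p.1) y (EuclideanSpace.single 2 1) 0 * fderiv ℝ (u p.1) y (EuclideanSpace.single 0 1) 2 +
              fderiv ℝ (u p.1) y (EuclideanSpace.single 2 1) 1 * fderiv ℝ (u p.1) y (EuclideanSpace.single 1 1) 2) /
            (fderiv ℝ (u p.1) y (EuclideanSpace.single 0 1) 2 ^ 2 + fderiv ℝ (u p.1) y (EuclideanSpace.single 1 1) 2 ^ 2)) p.2 (EuclideanSpace.single 1 1) * fderiv ℝ (u p.1) p.2 (EuclideanSpace.single 1 1) 2 ≠ 0) →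
        False) :
    ∀ (u : ℝ → EuclideanSpace ℝ (Fin 3) → EuclideanSpace ℝ (Fin 3)) (q : ℝ → EuclideanSpace ℝ (Fin 3) → ℝ)
        (U : Set (ℝ × EuclideanSpace ℝ (Fin 3))),
        IsOpen U → U.Nonempty →
        Literature.Analysis.FluidPDE.IsClassicalNSSolutionOnRegion U 1 0 u q →
        AnalyticOnNhd ℝ (Function.uncurry u) U →
        (∀ p ∈ U, ⟪Literature.Analysis.FluidPDE.curl (u p.1) p.2, EuclideanSpace.single 2 1⟫_ℝ = 0) →
        (∀ p ∈ U, fderiv ℝ (u p.1) p.2 (EuclideanSpace.single 2 1) 0 * fderiv ℝ (u p.1) p.2 (EuclideanSpace.single 1 1) 2 =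
          fderiv ℝ (u p.1) p.2 (EuclideanSpace.single 2 1) 1 * fderiv ℝ (u p.1) p.2 (EuclideanSpace.single 0 1) 2) →
        (∀ p ∈ U, Literature.Analysis.FluidPDE.curl (u p.1) p.2 ≠ 0 ∧
          (fderiv ℝ (u p.1) p.2 (EuclideanSpace.single 0 1) 2 ≠ 0 ∨ fderiv ℝ (u p.1) p.2 (EuclideanSpace.single 1 1) 2 ≠ 0) ∧
          (fderiv ℝ (u p.1) p.2 (EuclideanSpace.single 2 1) 0 ≠ 0 ∨ fderiv ℝ (u p.1) p.2 (EuclideanSpace.single 2 1) 1 ≠ 0)) →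
        (∀ p ∈ U,
          fderiv ℝ (fun y => fderiv ℝ (u p.1) y (EuclideanSpace.single 2 1) 2) p.2 (EuclideanSpace.single 0 1) *
              fderiv ℝ (u p.1) p.2 (EuclideanSpace.single 1 1) 2 -
            fderiv ℝ (fun y => fderiv ℝ (u p.1) y (EuclideanSpace.single 2 1) 2) p.2 (EuclideanSpace.single 1 1) *
              fderiv ℝ (u p.1) p.2 (EuclideanSpace.single 0 1) 2 ≠ 0) →
        (∀ p ∈ U,
          fderiv ℝ (fun y => (fderiv ℝ (u p.1) y (EuclideanSpace.single 2 1) 0 * fderiv ℝ (u p.1) y (EuclideanSpace.single 0 1) 2 +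
              fderiv ℝ (u p.1) y (EuclideanSpace.single 2 1) 1 * fderiv ℝ (u p.1) y (EuclideanSpace.single 1 1) 2) /
            (fderiv ℝ (u p.1) y (EuclideanSpace.single 0 1) 2 ^ 2 + fderiv ℝ (u p.1) y (EuclideanSpace.single 1 1) 2 ^ 2)) p.2 (EuclideanSpace.single 0 1) ≠ 0 ∨
          fderiv ℝ (fun y => (fderiv ℝ (u p.1) y (EuclideanSpace.single 2 1) 0 * fderiv ℝ (u p.1) y (EuclideanSpace.single 0 1) 2 +
              fderiv ℝ (u p.1) y (EuclideanSpace.single 2 1) 1 * fderiv ℝ (u p.1) y (EuclideanSpace.single 1 1) 2) /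
            (fderiv ℝ (u p.1) y (EuclideanSpace.single 0 1) 2 ^ 2 + fderiv ℝ (u p.1) y (EuclideanSpace.single 1 1) 2 ^ 2)) p.2 (EuclideanSpace.single 1 1) ≠ 0) →
        False := by
  intro u q U hU hUne hreg han hpol hfr hnd htw hpin
  -- the leafwise identity at every point of `U`
  have hsec : ∀ p ∈ U, ∀ᶠ y in 𝓝 p.2, (p.1, y) ∈ U := fun p hp =>
    (hU.preimage (Continuous.prodMk_right p.1)).mem_nhds (by simpa using hp)
  have hleafU : ∀ p ∈ U,
      fderiv ℝ (fun y => (fderiv ℝ (u p.1) y (EuclideanSpace.single 2 1) 0 * fderiv ℝ (u p.1) y (EuclideanSpace.single 0 1) 2 +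
              fderiv ℝ (u p.1) y (EuclideanSpace.single 2 1) 1 * fderiv ℝ (u p.1) y (EuclideanSpace.single 1 1) 2) /
            (fderiv ℝ (u p.1) y (EuclideanSpace.single 0 1) 2 ^ 2 + fderiv ℝ (u p.1) y (EuclideanSpace.single 1 1) 2 ^ 2)) p.2 (EuclideanSpace.single 0 1) * fderiv ℝ (u p.1) p.2 (EuclideanSpace.single 1 1) 2 =
      fderiv ℝ (fun y => (fderiv ℝ (u p.1) y (EuclideanSpace.single 2 1) 0 * fderiv ℝ (u p.1) y (EuclideanSpace.single 0 1) 2 +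
              fderiv ℝ (u p.1) y (EuclideanSpace.single 2 1) 1 * fderiv ℝ (u p.1) y (EuclideanSpace.single 1 1) 2) /
            (fderiv ℝ (u p.1) y (EuclideanSpace.single 0 1) 2 ^ 2 + fderiv ℝ (u p.1) y (EuclideanSpace.single 1 1) 2 ^ 2)) p.2 (EuclideanSpace.single 1 1) * fderiv ℝ (u p.1) p.2 (EuclideanSpace.single 0 1) 2 := by
    intro p hp
    have hV : ContDiffAt ℝ 2 (u p.1) p.2 := by
      have ha : AnalyticAt ℝ (uncurry u) (p.1, p.2) := han p hp
      exact (analyticAt_slice ha).contDiffAt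
    refine slopeGrad_cross_grad_eq_zero hV ?_ ?_ ?_
    · filter_upwards [hsec p hp] with y hy
      have h := hpol (p.1, y) hy
      have h2 : curl (u p.1) y 2 = 0 := by simpa [EuclideanSpace.inner_single_right] using h
      rw [curl_apply_two_eq] at h2
      linarith
    · filter_upwards [hsec p hp] with y hy
      exact hfr (p.1, y) hy
    · filter_upwards [hsec p hp] with y hy
      exact (hnd (p.1, y) hy).2.1
  exact hleaf u q U hU hUne hreg han hpol hfr hnd htw hleafU
    (fun p hp => inner_ne_zero_of_cross_eq_zero (hleafU p hp) (hpin p hp) (hnd p hp).2.1)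

/-- **`stub_twistingThick` (`twist_split` v4, item 20428) VERBATIM from `hleaf`.** -/
theorem stub_twistingThick_of_localThickLeaf
    (hleaf : ∀ (u : ℝ → EuclideanSpace ℝ (Fin 3) → EuclideanSpace ℝ (Fin 3)) (q : ℝ → EuclideanSpace ℝ (Fin 3) → ℝ)
        (U : Set (ℝ × EuclideanSpace ℝ (Fin 3))),
        IsOpen U → U.Nonempty →
        Literature.Analysis.FluidPDE.IsClassicalNSSolutionOnRegion U 1 0 u q →
        AnalyticOnNhd ℝ (Function.uncurry u) U →
        (∀ p ∈ U, ⟪Literature.Analysis.FluidPDE.curl (u p.1) p.2, EuclideanSpace.single 2 1⟫_ℝ = 0) →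
        (∀ p ∈ U, fderiv ℝ (u p.1) p.2 (EuclideanSpace.single 2 1) 0 * fderiv ℝ (u p.1) p.2 (EuclideanSpace.single 1 1) 2 =
          fderiv ℝ (u p.1) p.2 (EuclideanSpace.single 2 1) 1 * fderiv ℝ (u p.1) p.2 (EuclideanSpace.single 0 1) 2) →
        (∀ p ∈ U, Literature.Analysis.FluidPDE.curl (u p.1) p.2 ≠ 0 ∧
          (fderiv ℝ (u p.1) p.2 (EuclideanSpace.single 0 1) 2 ≠ 0 ∨ fderiv ℝ (u p.1) p.2 (EuclideanSpace.single 1 1) 2 ≠ 0) ∧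
          (fderiv ℝ (u p.1) p.2 (EuclideanSpace.single 2 1) 0 ≠ 0 ∨ fderiv ℝ (u p.1) p.2 (EuclideanSpace.single 2 1) 1 ≠ 0)) →
        (∀ p ∈ U,
          fderiv ℝ (fun y => fderiv ℝ (u p.1) y (EuclideanSpace.single 2 1) 2) p.2 (EuclideanSpace.single 0 1) *
              fderiv ℝ (u p.1) p.2 (EuclideanSpace.single 1 1) 2 -
            fderiv ℝ (fun y => fderiv ℝ (u p.1) y (EuclideanSpace.single 2 1) 2) p.2 (EuclideanSpace.single 1 1) *
              fderiv ℝ (u p.1) p.2 (EuclideanSpace.single 0 1) 2 ≠ 0) →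
        (∀ p ∈ U,
          fderiv ℝ (fun y => (fderiv ℝ (u p.1) y (EuclideanSpace.single 2 1) 0 * fderiv ℝ (u p.1) y (EuclideanSpace.single 0 1) 2 +
              fderiv ℝ (u p.1) y (EuclideanSpace.single 2 1) 1 * fderiv ℝ (u p.1) y (EuclideanSpace.single 1 1) 2) /
            (fderiv ℝ (u p.1) y (EuclideanSpace.single 0 1) 2 ^ 2 + fderiv ℝ (u p.1) y (EuclideanSpace.single 1 1) 2 ^ 2)) p.2 (EuclideanSpace.single 0 1) * fderiv ℝ (u p.1) p.2 (EuclideanSpace.single 1 1) 2 =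
          fderiv ℝ (fun y => (fderiv ℝ (u p.1) y (EuclideanSpace.single 2 1) 0 * fderiv ℝ (u p.1) y (EuclideanSpace.single 0 1) 2 +
              fderiv ℝ (u p.1) y (EuclideanSpace.single 2 1) 1 * fderiv ℝ (u p.1) y (EuclideanSpace.single 1 1) 2) /
            (fderiv ℝ (u p.1) y (EuclideanSpace.single 0 1) 2 ^ 2 + fderiv ℝ (u p.1) y (EuclideanSpace.single 1 1) 2 ^ 2)) p.2 (EuclideanSpace.single 1 1) * fderiv ℝ (u p.1) p.2 (EuclideanSpace.single 0 1) 2) →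
        (∀ p ∈ U,
          fderiv ℝ (fun y => (fderiv ℝ (u p.1) y (EuclideanSpace.single 2 1) 0 * fderiv ℝ (u p.1) y (EuclideanSpace.single 0 1) 2 +
              fderiv ℝ (u p.1) y (EuclideanSpace.single 2 1) 1 * fderiv ℝ (u p.1) y (EuclideanSpace.single 1 1) 2) /
            (fderiv ℝ (u p.1) y (EuclideanSpace.single 0 1) 2 ^ 2 + fderiv ℝ (u p.1) y (EuclideanSpace.single 1 1) 2 ^ 2)) p.2 (EuclideanSpace.single 0 1) * fderiv ℝ (u p.1) p.2 (EuclideanSpace.single 0 1) 2 +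
          fderiv ℝ (fun y => (fderiv ℝ (u p.1) y (EuclideanSpace.single 2 1) 0 * fderiv ℝ (u p.1) y (EuclideanSpace.single 0 1) 2 +
              fderiv ℝ (u p.1) y (EuclideanSpace.single 2 1) 1 * fderiv ℝ (u p.1) y (EuclideanSpace.single 1 1) 2) /
            (fderiv ℝ (u p.1) y (EuclideanSpace.single 0 1) 2 ^ 2 + fderiv ℝ (u p.1) y (EuclideanSpace.single 1 1) 2 ^ 2)) p.2 (EuclideanSpace.single 1 1) * fderiv ℝ (u p.1) p.2 (EuclideanSpace.single 1 1) 2 ≠ 0) →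
        False) :
    ∀ (C : ℝ) (v : ℝ → EuclideanSpace ℝ (Fin 3) → EuclideanSpace ℝ (Fin 3)),
      Literature.Analysis.FluidPDE.HasTypeITimeDecay C v →
      ContinuousOn (Function.uncurry v) (Set.Iio (0 : ℝ) ×ˢ Set.univ) →
      (∀ s t : ℝ, s < t → t < 0 → ∀ x, v t x =
        Literature.Analysis.UnboundedOperators.heatExtension (v s) (t - s) x -
          Literature.Analysis.FluidPDE.oseenDuhamel 1 s v v t x) →
      (∀ t < 0, Literature.Analysis.FluidPDE.VectorCalculus.IsDivFree (v t)) →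
      (∀ s < 0, ∀ y, ⟪Literature.Analysis.FluidPDE.curl (v s) y, EuclideanSpace.single 2 1⟫_ℝ = 0) →
      ∀ W : Set (ℝ × EuclideanSpace ℝ (Fin 3)), IsOpen W → W.Nonempty → W ⊆ Set.Iio (0 : ℝ) ×ˢ Set.univ →
        (∀ z ∈ W, Literature.Analysis.FluidPDE.curl (v z.1) z.2 ≠ 0 ∧
          (fderiv ℝ (v z.1) z.2 (EuclideanSpace.single 0 1) 2 ≠ 0 ∨ fderiv ℝ (v z.1) z.2 (EuclideanSpace.single 1 1) 2 ≠ 0) ∧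
          (fderiv ℝ (v z.1) z.2 (EuclideanSpace.single 2 1) 0 ≠ 0 ∨ fderiv ℝ (v z.1) z.2 (EuclideanSpace.single 2 1) 1 ≠ 0)) →
        (∀ m : ℝ → ℝ, ∀ W₁ : Set (ℝ × EuclideanSpace ℝ (Fin 3)), W₁ ⊆ W → IsOpen W₁ → W₁.Nonempty →
          ∃ z ∈ W₁, ∃ b : Fin 3, b ≠ 2 ∧
            fderiv ℝ (v z.1) z.2 (EuclideanSpace.single 2 1) b ≠
              m z.1 * fderiv ℝ (v z.1) z.2 (EuclideanSpace.single b 1) 2) →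
        (∀ z ∈ W,
          fderiv ℝ (fun x => fderiv ℝ (v z.1) x (EuclideanSpace.single 2 1) 2) z.2 (EuclideanSpace.single 0 1) *
              fderiv ℝ (v z.1) z.2 (EuclideanSpace.single 1 1) 2 -
            fderiv ℝ (fun x => fderiv ℝ (v z.1) x (EuclideanSpace.single 2 1) 2) z.2 (EuclideanSpace.single 1 1) *
              fderiv ℝ (v z.1) z.2 (EuclideanSpace.single 0 1) 2 ≠ 0) →
        (∀ m : ℝ → ℝ → ℝ, ∀ W₁ : Set (ℝ × EuclideanSpace ℝ (Fin 3)), W₁ ⊆ W → IsOpen W₁ → W₁.Nonempty →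
          ∃ z ∈ W₁, ∃ b : Fin 3, b ≠ 2 ∧
            fderiv ℝ (v z.1) z.2 (EuclideanSpace.single 2 1) b ≠
              m z.1 (z.2 2) * fderiv ℝ (v z.1) z.2 (EuclideanSpace.single b 1) 2) →
        ∃ s : ℝ, s < 0 ∧ ∃ U : Set (EuclideanSpace ℝ (Fin 3)), IsOpen U ∧ U.Nonempty ∧
          ((∃ e : EuclideanSpace ℝ (Fin 3), e ≠ 0 ∧
              ∀ y ∈ U, fderiv ℝ (Literature.Analysis.FluidPDE.curl (v s)) y e = 0) ∨
           (∃ c : EuclideanSpace ℝ (Fin 3), ∀ y ∈ U,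
              Literature.Analysis.FluidPDE.rotGen (Literature.Analysis.FluidPDE.curl (v s) y) =
                fderiv ℝ (Literature.Analysis.FluidPDE.curl (v s)) y (Literature.Analysis.FluidPDE.rotGen (y - c))) ∨
           (∃ w : EuclideanSpace ℝ (Fin 3) → EuclideanSpace ℝ (Fin 3), AnalyticOnNhd ℝ w Set.univ ∧
              ¬ BddAbove (Set.range fun y => ‖w y‖) ∧ ∀ y ∈ U, v s y = w y)) :=
  stub_twistingThick_of_localThickOpen (localThickOpen_of_localThickLeaf hleaf)

/-- **`stub_hyperbolicThick` (`mixed_type` v1, crux 19708) VERBATIM from `hleaf`.** -/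
theorem stub_hyperbolicThick_of_localThickLeaf
    (hleaf : ∀ (u : ℝ → EuclideanSpace ℝ (Fin 3) → EuclideanSpace ℝ (Fin 3)) (q : ℝ → EuclideanSpace ℝ (Fin 3) → ℝ)
        (U : Set (ℝ × EuclideanSpace ℝ (Fin 3))),
        IsOpen U → U.Nonempty →
        Literature.Analysis.FluidPDE.IsClassicalNSSolutionOnRegion U 1 0 u q →
        AnalyticOnNhd ℝ (Function.uncurry u) U →
        (∀ p ∈ U, ⟪Literature.Analysis.FluidPDE.curl (u p.1) p.2, EuclideanSpace.single 2 1⟫_ℝ = 0) →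
        (∀ p ∈ U, fderiv ℝ (u p.1) p.2 (EuclideanSpace.single 2 1) 0 * fderiv ℝ (u p.1) p.2 (EuclideanSpace.single 1 1) 2 =
          fderiv ℝ (u p.1) p.2 (EuclideanSpace.single 2 1) 1 * fderiv ℝ (u p.1) p.2 (EuclideanSpace.single 0 1) 2) →
        (∀ p ∈ U, Literature.Analysis.FluidPDE.curl (u p.1) p.2 ≠ 0 ∧
          (fderiv ℝ (u p.1) p.2 (EuclideanSpace.single 0 1) 2 ≠ 0 ∨ fderiv ℝ (u p.1) p.2 (EuclideanSpace.single 1 1) 2 ≠ 0) ∧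
          (fderiv ℝ (u p.1) p.2 (EuclideanSpace.single 2 1) 0 ≠ 0 ∨ fderiv ℝ (u p.1) p.2 (EuclideanSpace.single 2 1) 1 ≠ 0)) →
        (∀ p ∈ U,
          fderiv ℝ (fun y => fderiv ℝ (u p.1) y (EuclideanSpace.single 2 1) 2) p.2 (EuclideanSpace.single 0 1) *
              fderiv ℝ (u p.1) p.2 (EuclideanSpace.single 1 1) 2 -
            fderiv ℝ (fun y => fderiv ℝ (u p.1) y (EuclideanSpace.single 2 1) 2) p.2 (EuclideanSpace.single 1 1) *
              fderiv ℝ (u p.1) p.2 (EuclideanSpace.single 0 1) 2 ≠ 0) →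
        (∀ p ∈ U,
          fderiv ℝ (fun y => (fderiv ℝ (u p.1) y (EuclideanSpace.single 2 1) 0 * fderiv ℝ (u p.1) y (EuclideanSpace.single 0 1) 2 +
              fderiv ℝ (u p.1) y (EuclideanSpace.single 2 1) 1 * fderiv ℝ (u p.1) y (EuclideanSpace.single 1 1) 2) /
            (fderiv ℝ (u p.1) y (EuclideanSpace.single 0 1) 2 ^ 2 + fderiv ℝ (u p.1) y (EuclideanSpace.single 1 1) 2 ^ 2)) p.2 (EuclideanSpace.single 0 1) * fderiv ℝ (u p.1) p.2 (EuclideanSpace.single 1 1) 2 =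
          fderiv ℝ (fun y => (fderiv ℝ (u p.1) y (EuclideanSpace.single 2 1) 0 * fderiv ℝ (u p.1) y (EuclideanSpace.single 0 1) 2 +
              fderiv ℝ (u p.1) y (EuclideanSpace.single 2 1) 1 * fderiv ℝ (u p.1) y (EuclideanSpace.single 1 1) 2) /
            (fderiv ℝ (u p.1) y (EuclideanSpace.single 0 1) 2 ^ 2 + fderiv ℝ (u p.1) y (EuclideanSpace.single 1 1) 2 ^ 2)) p.2 (EuclideanSpace.single 1 1) * fderiv ℝ (u p.1) p.2 (EuclideanSpace.single 0 1) 2) →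
        (∀ p ∈ U,
          fderiv ℝ (fun y => (fderiv ℝ (u p.1) y (EuclideanSpace.single 2 1) 0 * fderiv ℝ (u p.1) y (EuclideanSpace.single 0 1) 2 +
              fderiv ℝ (u p.1) y (EuclideanSpace.single 2 1) 1 * fderiv ℝ (u p.1) y (EuclideanSpace.single 1 1) 2) /
            (fderiv ℝ (u p.1) y (EuclideanSpace.single 0 1) 2 ^ 2 + fderiv ℝ (u p.1) y (EuclideanSpace.single 1 1) 2 ^ 2)) p.2 (EuclideanSpace.single 0 1) * fderiv ℝ (u p.1) p.2 (EuclideanSpace.single 0 1) 2 +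
          fderiv ℝ (fun y => (fderiv ℝ (u p.1) y (EuclideanSpace.single 2 1) 0 * fderiv ℝ (u p.1) y (EuclideanSpace.single 0 1) 2 +
              fderiv ℝ (u p.1) y (EuclideanSpace.single 2 1) 1 * fderiv ℝ (u p.1) y (EuclideanSpace.single 1 1) 2) /
            (fderiv ℝ (u p.1) y (EuclideanSpace.single 0 1) 2 ^ 2 + fderiv ℝ (u p.1) y (EuclideanSpace.single 1 1) 2 ^ 2)) p.2 (EuclideanSpace.single 1 1) * fderiv ℝ (u p.1) p.2 (EuclideanSpace.single 1 1) 2 ≠ 0) →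
        False) :
    ∀ (C : ℝ) (v : ℝ → EuclideanSpace ℝ (Fin 3) → EuclideanSpace ℝ (Fin 3)),
      Literature.Analysis.FluidPDE.HasTypeITimeDecay C v →
      ContinuousOn (Function.uncurry v) (Set.Iio (0 : ℝ) ×ˢ Set.univ) →
      (∀ s t : ℝ, s < t → t < 0 → ∀ x, v t x =
        Literature.Analysis.UnboundedOperators.heatExtension (v s) (t - s) x -
          Literature.Analysis.FluidPDE.oseenDuhamel 1 s v v t x) →
      (∀ t < 0, Literature.Analysis.FluidPDE.VectorCalculus.IsDivFree (v t)) →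
      (∀ s < 0, ∀ y, ⟪Literature.Analysis.FluidPDE.curl (v s) y, EuclideanSpace.single 2 1⟫_ℝ = 0) →
      ∀ W : Set (ℝ × EuclideanSpace ℝ (Fin 3)), IsOpen W → W.Nonempty → W ⊆ Set.Iio (0 : ℝ) ×ˢ Set.univ →
        (∀ z ∈ W, Literature.Analysis.FluidPDE.curl (v z.1) z.2 ≠ 0 ∧
          (fderiv ℝ (v z.1) z.2 (EuclideanSpace.single 0 1) 2 ≠ 0 ∨ fderiv ℝ (v z.1) z.2 (EuclideanSpace.single 1 1) 2 ≠ 0) ∧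
          (fderiv ℝ (v z.1) z.2 (EuclideanSpace.single 2 1) 0 ≠ 0 ∨ fderiv ℝ (v z.1) z.2 (EuclideanSpace.single 2 1) 1 ≠ 0)) →
        (∀ m : ℝ → ℝ, ∀ W₁ : Set (ℝ × EuclideanSpace ℝ (Fin 3)), W₁ ⊆ W → IsOpen W₁ → W₁.Nonempty →
          ∃ z ∈ W₁, ∃ b : Fin 3, b ≠ 2 ∧
            fderiv ℝ (v z.1) z.2 (EuclideanSpace.single 2 1) b ≠
              m z.1 * fderiv ℝ (v z.1) z.2 (EuclideanSpace.single b 1) 2) →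
        (∀ z ∈ W,
          fderiv ℝ (fun x => fderiv ℝ (v z.1) x (EuclideanSpace.single 2 1) 2) z.2 (EuclideanSpace.single 0 1) *
              fderiv ℝ (v z.1) z.2 (EuclideanSpace.single 1 1) 2 -
            fderiv ℝ (fun x => fderiv ℝ (v z.1) x (EuclideanSpace.single 2 1) 2) z.2 (EuclideanSpace.single 1 1) *
              fderiv ℝ (v z.1) z.2 (EuclideanSpace.single 0 1) 2 ≠ 0) →
        (∀ z ∈ W,
          fderiv ℝ (v z.1) z.2 (EuclideanSpace.single 2 1) 0 * fderiv ℝ (v z.1) z.2 (EuclideanSpace.single 0 1) 2 +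
            fderiv ℝ (v z.1) z.2 (EuclideanSpace.single 2 1) 1 * fderiv ℝ (v z.1) z.2 (EuclideanSpace.single 1 1) 2 < 0) →
        (∀ m : ℝ → ℝ → ℝ, ∀ W₁ : Set (ℝ × EuclideanSpace ℝ (Fin 3)), W₁ ⊆ W → IsOpen W₁ → W₁.Nonempty →
          ∃ z ∈ W₁, ∃ b : Fin 3, b ≠ 2 ∧
            fderiv ℝ (v z.1) z.2 (EuclideanSpace.single 2 1) b ≠
              m z.1 (z.2 2) * fderiv ℝ (v z.1) z.2 (EuclideanSpace.single b 1) 2) →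
        ¬ Literature.Analysis.FluidPDE.IsBackwardSingularPoint v 0 :=
  stub_hyperbolicThick_of_localHypThickOpen fun u q U hU hUne hreg han hpol hfr hnd htw _hhyp hpin =>
    localThickOpen_of_localThickLeaf hleaf u q U hU hUne hreg han hpol hfr hnd htw hpin

end Summit.NavierStokesRegularity.NavierStokesRegularity.Theorems.PoloidalWindowDoorLrcModEntireTwistingThickLeafwise

end
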